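import Literature.Analysis.Matrix.GramSchmidtIntegerColumns
import Literature.Analysis.SpecialFunctions.IntegerRoundSqrt
import Literature.Algebra.EuclideanLattices.GramSchmidtTableLists
import HarnessLib

/-!
# The rounded exact Gram–Schmidt unit matrix as a list program

Family `quantum-advantage`, the mathematics of one stage of the reduction machine of the discharge
of Aaronson–Arkhipov's Thm. 1.3 (`gpeSolvableInFBPPRel_NPRel_of_approxBosonSamplingOracle`): from a
matrix `B` of Gaussian integers (an `m × n` list of integer pairs) the machine must produce the
`b`-bit roundings `round(2ᵇ re U_{rc})`, `round(2ᵇ im U_{rc})` of the EXACTLY column-orthonormal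
`U = gsUnit (gaussIntMatrix B)` (`GramSchmidtIntegerColumns.lean`). It does so with integers only:

* `reColL`, `imColL`, `dblRowsL`, `stdRowsL`, **`extRowsL`** — the rows of the extended family
  `extFamily B` (realified columns interleaved with their `i`-multiples, then the standard basis)
  as lists (`extRowsL_rowsOf`, with `rowsOf B` the list of rows of `B`);
* `gsLevels` — Cohen's integer table on them (`GramSchmidtTableLists.levelsOf`, `2n` levels, the
  first `2n` columns);
* `roundGS x d d' P` — the rounding `roundDivSqrt (P x) (d d')` (`IntegerRoundSqrt.lean`) of
  `P · x / √(d d')`; `entryOf`, **`roundedGS b rows n`** — the output matrix of pairs;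
* **`roundedGS_rowsOf`** — for `B` with `ℂ`-independent columns,
  `roundedGS b (rows of B) n = (round (2ᵇ re U_{rc}), round (2ᵇ im U_{rc}))_{r,c}` with
  `U = gsUnit (gaussIntMatrix B)`: the table entries are `uRec (extFamily B)` values
  (`tabEntry_tableRec_eq_uRec` + reindexing), which `gsUnit_re_eq`/`gsUnit_im_eq` turn into the
  entries of `U`, and `round_two_pow_mul_div_sqrt` into the integer rounding.

All proved; the typed polynomial-time computation of `roundedGS` is `GramSchmidtRoundingMachine.lean`.

## References

* H. Cohen, *A Course in Computational Algebraic Number Theory*, GTM 138, Springer 1993, §2.6.3 and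
  Algorithm 2.6.7; Algorithm 1.7.1 (integer square root).
* S. Aaronson, A. Arkhipov, *The computational complexity of linear optics*, Theory of Computing 9
  (2013) 143–252, §5.2 (p. 192) and §2 (p. 161: entries rounded to `poly(n)` bits).
-/

noncomputable section

namespace Literature.Computability.QuantumComplexity

open Literature.Algebra.EuclideanLattices Literature.Analysis.Matrix Literature.Analysis.SpecialFunctions

/-! ### The extended rows as lists -/

/-- The realified column `c`: real parts of the rows, then imaginary parts. [folklore] -/
def reColL (rows : List (List (ℤ × ℤ))) (c : ℕ) : List ℤ :=
  (rows.map fun row => (row.getD c (0, 0)).1) ++ (rows.map fun row => (row.getD c (0, 0)).2)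

/-- The realification of `i ·` column `c`: `(-im, re)`. [folklore] -/
def imColL (rows : List (List (ℤ × ℤ))) (c : ℕ) : List ℤ :=
  (rows.map fun row => -(row.getD c (0, 0)).2) ++ (rows.map fun row => (row.getD c (0, 0)).1)

/-- The doubled rows `(re 0, im 0, re 1, im 1, …)` for the first `n` columns. [folklore] -/
def dblRowsL (rows : List (List (ℤ × ℤ))) (n : ℕ) : List (List ℤ) :=
  ((List.range n).map fun c => [reColL rows c, imColL rows c]).flatten

/-- The standard basis rows of `ℤᴰ`. [folklore] -/
def stdRowsL (D : ℕ) : List (List ℤ) :=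
  (List.range D).map fun t => (List.range D).map fun s => if s = t then 1 else 0

/-- **The extended rows**: doubled rows, then the standard basis of `ℤᴰ`. [folklore] -/
def extRowsL (rows : List (List (ℤ × ℤ))) (n D : ℕ) : List (List ℤ) := dblRowsL rows n ++ stdRowsL D

variable {m n : ℕ}

/-- The list of rows of an integer-pair matrix. [folklore] -/
def rowsOf (B : _root_.Matrix (Fin m) (Fin n) (ℤ × ℤ)) : List (List (ℤ × ℤ)) :=
  List.ofFn fun r => List.ofFn fun c => B r c

/-- Reading an entry off the rows. [folklore] -/
theorem getD_rowsOf (B : _root_.Matrix (Fin m) (Fin n) (ℤ × ℤ)) (r : Fin m) (c : Fin n) :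
    ((rowsOf B).getD r []).getD c (0, 0) = B r c := by
  simp [rowsOf, List.getD_eq_getElem?_getD]

/-- The row `r` of `rowsOf B`, read with a default. [folklore] -/
theorem getD_rowsOf_row (B : _root_.Matrix (Fin m) (Fin n) (ℤ × ℤ)) (r : Fin m) :
    (rowsOf B).getD r [] = List.ofFn fun c => B r c := by
  simp [rowsOf, List.getD_eq_getElem?_getD]

/-- An entry of a row of `rowsOf B`, read with a default, inside the range. [folklore] -/
theorem getD_ofFn_row (B : _root_.Matrix (Fin m) (Fin n) (ℤ × ℤ)) (r : Fin m) (c : Fin n) :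
    (List.ofFn fun c => B r c).getD c (0, 0) = B r c := by
  simp [List.getD_eq_getElem?_getD]

/-- `reCol` on the first half of the indices. [folklore] -/
theorem reCol_castLE (B : _root_.Matrix (Fin m) (Fin n) (ℤ × ℤ)) (c : Fin n) (r : Fin m) (h : m ≤ m + m) :
    reCol B c (Fin.castLE h r) = (B r c).1 := by
  rw [show Fin.castLE h r = Fin.castAdd m r from Fin.ext rfl]
  simp [reCol]

/-- `reCol` on the second half of the indices. [folklore] -/
theorem reCol_natAdd (B : _root_.Matrix (Fin m) (Fin n) (ℤ × ℤ)) (c : Fin n) (r : Fin m) :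
    reCol B c (Fin.natAdd m r) = (B r c).2 := by
  show Sum.elim _ _ (finSumFinEquiv.symm (Fin.natAdd m r)) = _
  rw [finSumFinEquiv_symm_apply_natAdd, Sum.elim_inr]

/-- `imCol` on the first half of the indices. [folklore] -/
theorem imCol_castLE (B : _root_.Matrix (Fin m) (Fin n) (ℤ × ℤ)) (c : Fin n) (r : Fin m) (h : m ≤ m + m) :
    imCol B c (Fin.castLE h r) = -(B r c).2 := by
  rw [show Fin.castLE h r = Fin.castAdd m r from Fin.ext rfl]
  simp [imCol]

/-- `imCol` on the second half of the indices. [folklore] -/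
theorem imCol_natAdd (B : _root_.Matrix (Fin m) (Fin n) (ℤ × ℤ)) (c : Fin n) (r : Fin m) :
    imCol B c (Fin.natAdd m r) = (B r c).1 := by
  show Sum.elim _ _ (finSumFinEquiv.symm (Fin.natAdd m r)) = _
  rw [finSumFinEquiv_symm_apply_natAdd, Sum.elim_inr]

/-- `reColL` of the rows of `B` is the list of `reCol B`. [folklore] -/
theorem reColL_rowsOf (B : _root_.Matrix (Fin m) (Fin n) (ℤ × ℤ)) (c : Fin n) :
    reColL (rowsOf B) c = List.ofFn (reCol B c) := by
  rw [List.ofFn_add, reColL, rowsOf, List.map_ofFn, List.map_ofFn]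
  congr 1
  · congr 1; funext r; rw [Function.comp_apply, reCol_castLE, getD_ofFn_row]
  · congr 1; funext r; rw [Function.comp_apply, reCol_natAdd, getD_ofFn_row]

/-- `imColL` of the rows of `B` is the list of `imCol B`. [folklore] -/
theorem imColL_rowsOf (B : _root_.Matrix (Fin m) (Fin n) (ℤ × ℤ)) (c : Fin n) :
    imColL (rowsOf B) c = List.ofFn (imCol B c) := by
  rw [List.ofFn_add, imColL, rowsOf, List.map_ofFn, List.map_ofFn]
  congr 1
  · congr 1; funext r; rw [Function.comp_apply, imCol_castLE, getD_ofFn_row]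
  · congr 1; funext r; rw [Function.comp_apply, imCol_natAdd, getD_ofFn_row]

/-- `dblCols` at an even index. [folklore] -/
theorem dblCols_even (B : _root_.Matrix (Fin m) (Fin n) (ℤ × ℤ)) (c : Fin n) (h : 2 * (c : ℕ) + 0 < 2 * n) :
    dblCols B ⟨2 * (c : ℕ) + 0, h⟩ = reCol B c := by
  unfold dblCols
  rw [if_pos (by simp)]
  congr 1; apply Fin.ext; simp

/-- `dblCols` at an odd index. [folklore] -/
theorem dblCols_odd (B : _root_.Matrix (Fin m) (Fin n) (ℤ × ℤ)) (c : Fin n) (h : 2 * (c : ℕ) + 1 < 2 * n) :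
    dblCols B ⟨2 * (c : ℕ) + 1, h⟩ = imCol B c := by
  unfold dblCols
  rw [if_neg (by simp)]
  congr 1; apply Fin.ext; dsimp only; omega

/-- The doubled rows of the rows of `B` are the lists of `dblCols B`. [folklore] -/
theorem dblRowsL_rowsOf (B : _root_.Matrix (Fin m) (Fin n) (ℤ × ℤ)) :
    dblRowsL (rowsOf B) n = List.ofFn fun l : Fin (2 * n) => List.ofFn (dblCols B l) := by
  rw [List.ofFn_mul', dblRowsL, ← List.map_coe_finRange_eq_range, List.map_map, List.ofFn_eq_map]
  congr 1
  apply List.map_congr_left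
  intro c _
  rw [List.ofFn_succ, List.ofFn_succ, List.ofFn_zero]
  simp only [Function.comp_apply, Fin.val_zero, Fin.val_succ]
  rw [dblCols_even B c, dblCols_odd B c, reColL_rowsOf, imColL_rowsOf]

/-- The standard rows as lists of `stdVec` on `Fin (m + m)`. [folklore] -/
theorem stdRowsL_add (m : ℕ) : stdRowsL (m + m) = List.ofFn fun t : Fin (m + m) => List.ofFn (stdVec t) := by
  unfold stdRowsL
  rw [← List.map_coe_finRange_eq_range, List.map_map, List.ofFn_eq_map]
  apply List.map_congr_left
  intro t _
  simp only [Function.comp_apply, List.map_map]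
  rw [List.ofFn_eq_map]
  apply List.map_congr_left
  intro s _
  simp only [Function.comp_apply, stdVec, Fin.ext_iff]

/-- **The extended rows of the rows of `B` are the lists of the extended family.** [folklore] -/
theorem extRowsL_rowsOf (B : _root_.Matrix (Fin m) (Fin n) (ℤ × ℤ)) :
    extRowsL (rowsOf B) n (m + m) = List.ofFn fun i : Fin (2 * n + (m + m)) => List.ofFn (extFamily B i) := by
  rw [List.ofFn_add, extRowsL, dblRowsL_rowsOf, stdRowsL_add]
  congr 1
  · congr 1; funext l
    rw [extFamily, show Fin.castLE (Nat.le_add_right (2 * n) (m + m)) l = Fin.castAdd (m + m) l from Fin.ext rfl,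
      Fin.append_left]
  · congr 1; funext t; rw [extFamily, Fin.append_right]

/-! ### Reindexing Cohen's recursion -/

/-- `uRec` is invariant under reindexing the family along an equality of lengths. [folklore] -/
theorem uRec_comp_cast {N N' D : ℕ} (h : N = N') (b : Fin N' → Fin D → ℤ) (l : ℕ) (i j : Fin N) :
    uRec (fun i => b (Fin.cast h i)) l i j = uRec b l (Fin.cast h i) (Fin.cast h j) := by
  subst h; rfl

/-- `dRec` is invariant under reindexing the family along an equality of lengths. [folklore] -/
theorem dRec_comp_cast {N N' D : ℕ} (h : N = N') (b : Fin N' → Fin D → ℤ) (l : ℕ) :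
    dRec (fun i => b (Fin.cast h i)) l = dRec b l := by
  subst h; rfl

/-- The padded family of a list of `ofFn` rows of common width is the original family, reindexed.
[folklore] -/
theorem padFamily_ofFn {N D : ℕ} (b : Fin N → Fin D → ℤ) :
    padFamily (List.ofFn fun i => List.ofFn (b i)) D =
      fun i => b (Fin.cast (List.length_ofFn) i) := by
  funext i t
  simp [padFamily, Fin.getElem_fin, List.getD_eq_getElem?_getD]
  rfl

/-- The width of a list of `ofFn` rows. [folklore] -/
theorem maxWidth_ofFn_le {N D : ℕ} (b : Fin N → Fin D → ℤ) :
    maxWidth (List.ofFn fun i => List.ofFn (b i)) ≤ D := by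
  unfold maxWidth
  suffices ∀ L : List (List ℤ), (∀ r ∈ L, r.length ≤ D) → (L.map List.length).foldr max 0 ≤ D from
    this _ fun r hr => by
      obtain ⟨i, rfl⟩ := List.mem_ofFn.1 hr
      simp
  intro L hL
  induction L with
  | nil => simp
  | cons a L ih =>
    rw [List.map_cons, List.foldr_cons]
    exact max_le (hL a (by simp)) (ih fun r hr => hL r (List.mem_cons_of_mem _ hr))

/-- **Cohen's list table on `ofFn` rows is `uRec` of the family.** [cite: Cohen1993, Algorithm 2.6.7] -/
theorem tabEntry_tableRec_ofFn {N D : ℕ} (b : Fin N → Fin D → ℤ) {C l : ℕ} (hl : l ≤ min C N)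
    (i : Fin N) {j : ℕ} (hj : j < min C N) :
    tabEntry (tableRec (List.ofFn fun i => List.ofFn (b i)) C l) i j = uRec b l i ⟨j, lt_of_lt_of_le hj (min_le_right _ _)⟩ := by
  have hlen : (List.ofFn fun i => List.ofFn (b i)).length = N := List.length_ofFn
  have hl' : l ≤ min C (List.ofFn fun i => List.ofFn (b i)).length := by rwa [hlen]
  have hj' : j < min C (List.ofFn fun i => List.ofFn (b i)).length := by rwa [hlen]
  have h := (tabEntry_tableRec_eq_uRec _ C (maxWidth_ofFn_le b) l hl').1 (i := i) (j := j)
    (by rw [hlen]; exact i.isLt) hj'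
  rw [h, padFamily_ofFn, uRec_comp_cast]
  rfl

/-- The `d`'s of Cohen's list table on `ofFn` rows are `dRec` of the family. [folklore] -/
theorem dList_ofFn {N D : ℕ} (b : Fin N → Fin D → ℤ) {C l : ℕ} (hl : l ≤ min C N) :
    dList (List.ofFn fun i => List.ofFn (b i)) C l = dRec b l := by
  have hlen : (List.ofFn fun i => List.ofFn (b i)).length = N := List.length_ofFn
  rw [dList_eq_dRec _ C (maxWidth_ofFn_le b) (by rwa [hlen]), padFamily_ofFn, dRec_comp_cast]

/-! ### The rounded entries -/

/-- Cohen's integer table of the extended rows: `2n` levels, the first `2n` columns. [folklore] -/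
def gsLevels (rows : List (List (ℤ × ℤ))) (n D : ℕ) : List (ℤ × List (List ℤ)) :=
  levelsOf (extRowsL rows n D) (2 * n) (2 * n)

/-- The rounding of `P x / √(d d')` with integers: `roundDivSqrt (P x) (d d')` (`d d' ≤ 0 ↦` junk).
[folklore] -/
def roundGS (x d d' : ℤ) (P : ℕ) : ℤ := roundDivSqrt (P * x) (d * d').toNat

/-- **The rounded entry `(r, c)`** read off the table: `d = d_{2c}`, `T = T_{2c}`, `d' = d_{2c+1}`,
`u_re = T(2n + r, 2c)`, `u_im = T(2n + m + r, 2c)`, each rounded as `round(P u / √(d d'))`. [folklore] -/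
def entryOf (P : ℕ) (Ls : List (ℤ × List (List ℤ))) (n m r c : ℕ) : ℤ × ℤ :=
  (roundGS (tabEntry (Ls.getD (2 * c) (0, [])).2 (2 * n + r) (2 * c))
      (Ls.getD (2 * c) (0, [])).1 (Ls.getD (2 * c + 1) (0, [])).1 P,
    roundGS (tabEntry (Ls.getD (2 * c) (0, [])).2 (2 * n + m + r) (2 * c))
      (Ls.getD (2 * c) (0, [])).1 (Ls.getD (2 * c + 1) (0, [])).1 P)

/-- **The rounded exact Gram–Schmidt unit matrix**, `b` bits, as a list program. [folklore] -/
def roundedGS (b : ℕ) (rows : List (List (ℤ × ℤ))) (n : ℕ) : List (List (ℤ × ℤ)) :=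
  (List.range rows.length).map fun r => (List.range n).map fun c =>
    entryOf (2 ^ b) (gsLevels rows n (rows.length + rows.length)) n rows.length r c

/-- The levels list read at an index below `2n`. [folklore] -/
theorem getD_gsLevels (rows : List (List (ℤ × ℤ))) (n D : ℕ) {l : ℕ} (hl : l < 2 * n) :
    (gsLevels rows n D).getD l (0, []) =
      (dList (extRowsL rows n D) (2 * n) l, tableRec (extRowsL rows n D) (2 * n) l) := by
  unfold gsLevels
  rw [levelsOf_eq, List.getD_eq_getElem _ _ (by simpa using hl), List.getElem_map, List.getElem_range]

/-- The integer rounding is the real rounding when `d, d' > 0`. [folklore] -/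
theorem roundGS_eq_round {x d d' : ℤ} (hd : 0 < d) (hd' : 0 < d') (b : ℕ) :
    roundGS x d d' (2 ^ b) = round ((2 : ℝ) ^ b * ((x : ℝ) / Real.sqrt ((d : ℝ) * d'))) := by
  have hD : 0 < (d * d').toNat := by
    have : 0 < d * d' := mul_pos hd hd'
    omega
  have hcast : (d : ℝ) * d' = (((d * d').toNat : ℕ) : ℝ) := by
    have h0 : 0 ≤ d * d' := (mul_pos hd hd').le
    rw [show (((d * d').toNat : ℕ) : ℝ) = (((d * d').toNat : ℤ) : ℝ) by norm_cast, Int.toNat_of_nonneg h0]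
    push_cast; ring
  rw [hcast, round_two_pow_mul_div_sqrt b x hD, roundGS]
  push_cast
  ring_nf

/-- **The list program rounds the exact Gram–Schmidt unit matrix**: for a Gaussian-integer matrix
`B` with `ℂ`-independent columns,
`roundedGS b (rows of B) n = (round(2ᵇ re U_{rc}), round(2ᵇ im U_{rc}))` row by row, where
`U = gsUnit (gaussIntMatrix B)`. [cite: AaronsonArkhipovToC2013, §5.2 (p. 192) with §2 (p. 161)] -/
theorem roundedGS_rowsOf (b : ℕ) (B : _root_.Matrix (Fin m) (Fin n) (ℤ × ℤ))
    (hli : LinearIndependent ℂ (colVec (gaussIntMatrix B))) :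
    roundedGS b (rowsOf B) n = List.ofFn fun r : Fin m => List.ofFn fun c : Fin n =>
      (round ((2 : ℝ) ^ b * (gsUnit (gaussIntMatrix B) r c).re),
        round ((2 : ℝ) ^ b * (gsUnit (gaussIntMatrix B) r c).im)) := by
  have hm : (rowsOf B).length = m := List.length_ofFn
  rw [roundedGS, hm, ← List.map_coe_finRange_eq_range (n := m), List.map_map, List.ofFn_eq_map]
  apply List.map_congr_left
  intro r _
  simp only [Function.comp_apply]
  rw [← List.map_coe_finRange_eq_range (n := n), List.map_map, List.ofFn_eq_map]
  apply List.map_congr_left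
  intro c _
  simp only [Function.comp_apply]
  -- the table data at levels `2c` and `2c + 1`
  have hc2 : 2 * (c : ℕ) < 2 * n := by omega
  have hc3 : 2 * (c : ℕ) + 1 < 2 * n := by omega
  set rows := extRowsL (rowsOf B) n (m + m) with hrows
  have hext : rows = List.ofFn fun i : Fin (2 * n + (m + m)) => List.ofFn (extFamily B i) := extRowsL_rowsOf B
  have hN : min (2 * n) (2 * n + (m + m)) = 2 * n := min_eq_left (Nat.le_add_right _ _)
  have hd : dList rows (2 * n) (2 * c) = dRec (extFamily B) (2 * c) := by
    rw [hext]; exact dList_ofFn _ (by rw [hN]; omega)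
  have hd' : dList rows (2 * n) (2 * c + 1) = dRec (extFamily B) (2 * c + 1) := by
    rw [hext]; exact dList_ofFn _ (by rw [hN]; omega)
  have hu : ∀ i : Fin (2 * n + (m + m)), tabEntry (tableRec rows (2 * n) (2 * c)) i (2 * c) =
      uRec (extFamily B) (2 * c) i ⟨2 * c, by omega⟩ := fun i => by
    rw [hext]; exact tabEntry_tableRec_ofFn _ (by rw [hN]; omega) i (by rw [hN]; omega)
  have hpos := dRec_extFamily_pos B hli (2 * c) hc2.le
  have hpos' := dRec_extFamily_pos B hli (2 * c + 1) (by omega)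
  unfold entryOf
  rw [getD_gsLevels _ _ _ hc2, getD_gsLevels _ _ _ hc3]
  simp only
  rw [hd, hd']
  have hre : (2 * n + (r : ℕ)) = ((reRow m n r : Fin (2 * n + (m + m))) : ℕ) := by
    simp [reRow, Fin.natAdd]
  have him : (2 * n + m + (r : ℕ)) = ((imRow m n r : Fin (2 * n + (m + m))) : ℕ) := by
    simp [imRow, Fin.natAdd]; omega
  rw [hre, hu (reRow m n r), him, hu (imRow m n r), roundGS_eq_round hpos hpos', roundGS_eq_round hpos hpos',
    gsUnit_re_eq B hli r c, gsUnit_im_eq B hli r c]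

end Literature.Computability.QuantumComplexity
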